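import Summits.NavierStokesRegularity.NavierStokesRegularity.Theorems.SymmetryModuliCountSymmetricLiouvilleKernelTimeWeightIntegral
import HarnessLib

/-!
# The localised Kato gap for Type-I ancient mild fields, I: kernel comparisons and time integrals

Summits-side theorem file (kind = proof, no definitions): elementary tools for the localised Kato gap
(`ExtremiserTransienceLocalKatoGap.lean`, a symmetry-free backward-persistence lemma for the Type-I ancient mild
class `A_C`, serving the rungs of LINE g9-β `filament_selection` on crux stmt-NavierStokesRegularity-26567):

* `kernelSq_le_four_mul` — off a ball of radius `g` the parabolic kernel `(a + ‖w‖²)^{-2}` is dominated by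
  `4(a + g² + ‖w‖²)^{-2}`; `rpow_neg_half_add_sq_le` — AM–GM `(θ + (vθ)²)^{-1/2} ≤ (2v)^{-1/2}θ^{-3/4}`;
* one-dimensional `∫⁻` computations: `∫₀ᵇ θ^{-3/4} = 4b^{1/4}`, reflection and shift of the past, the OLD-TIME
  integral `∫_{σ<−S} c(τ−σ)^{-1/2}(−σ)⁻¹ ≤ 2√2c/√S`, `(16a²)^{1/4} = 2√a`;
* `lintegral_slice_le` — the space integral of one time slice of the Oseen source `(a+‖y−z‖²)^{-2}‖f z‖²` split
  by a near/far predicate: near points by a weight, far points (at distance `≥ g`) through the tree's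
  `lintegral_kernelSq_mul_const` at the shifted time `a + g²`.

References: Koch–Nadirashvili–Seregin–Šverák, Acta Math. 203 (2009) = arXiv:0709.3599, §4 ((3.8), (4.3)–(4.4)).
-/

noncomputable section

set_option linter.dupNamespace false

open Set Function Filter MeasureTheory Metric
open scoped Topology ENNReal NNReal
open Literature.Analysis Literature.Analysis.FluidPDE
open Summit.NavierStokesRegularity.NavierStokesRegularity.Theorems.SymmetryModuliCountSymmetricLiouville

namespace Summit.NavierStokesRegularity.NavierStokesRegularity.Theorems.NearExtremalTransiencePerFlow.LocalKatoGap


/-! ## Elementary kernel comparisons -/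

/-- Off a ball the parabolic kernel is dominated by the kernel with the squared radius added to the time:
for `0 ≤ a`, `0 ≤ g ≤ ‖w‖`, `(a + ‖w‖²)⁻¹ ^ 2 ≤ 4 · (a + g² + ‖w‖²)⁻¹ ^ 2`. -/
theorem kernelSq_le_four_mul {a g : ℝ} {w : EuclideanSpace ℝ (Fin 3)} (ha : 0 ≤ a) (hg : 0 ≤ g) (hgw : g ≤ ‖w‖) :
    (a + ‖w‖ ^ 2)⁻¹ ^ 2 ≤ 4 * (a + g ^ 2 + ‖w‖ ^ 2)⁻¹ ^ 2 := by
  have hg2 : g ^ 2 ≤ ‖w‖ ^ 2 := pow_le_pow_left₀ hg hgw 2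
  rcases eq_or_lt_of_le (add_nonneg ha (sq_nonneg ‖w‖)) with h0 | hpos
  · -- degenerate case `a + ‖w‖² = 0`
    rw [← h0, inv_zero, zero_pow two_ne_zero]
    positivity
  have h2 : a + g ^ 2 + ‖w‖ ^ 2 ≤ 2 * (a + ‖w‖ ^ 2) := by nlinarith
  have hpos' : 0 < a + g ^ 2 + ‖w‖ ^ 2 := by nlinarith
  have hinv : (a + ‖w‖ ^ 2)⁻¹ ≤ 2 * (a + g ^ 2 + ‖w‖ ^ 2)⁻¹ := by
    rw [inv_le_comm₀ hpos (by positivity), mul_inv, inv_inv]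
    linarith
  calc (a + ‖w‖ ^ 2)⁻¹ ^ 2 ≤ (2 * (a + g ^ 2 + ‖w‖ ^ 2)⁻¹) ^ 2 :=
        pow_le_pow_left₀ (inv_nonneg.2 hpos.le) hinv 2
    _ = 4 * (a + g ^ 2 + ‖w‖ ^ 2)⁻¹ ^ 2 := by ring

/-- AM–GM for the affinely separated exterior: for `θ, v > 0`,
`(θ + (vθ)²)^{-1/2} ≤ (2v)^{-1/2} θ^{-3/4}` (since `θ + v²θ² ≥ 2vθ^{3/2}`). -/
theorem rpow_neg_half_add_sq_le {θ v : ℝ} (hθ : 0 < θ) (hv : 0 < v) :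
    (θ + (v * θ) ^ 2) ^ (-(1 / 2 : ℝ)) ≤ (2 * v) ^ (-(1 / 2 : ℝ)) * θ ^ (-(3 / 4 : ℝ)) := by
  have h32 : θ ^ (3 / 2 : ℝ) = θ * Real.sqrt θ := by
    rw [show (3 / 2 : ℝ) = 1 + 1 / 2 by norm_num, Real.rpow_add hθ, Real.rpow_one, Real.sqrt_eq_rpow]
  -- AM–GM: `2 v θ^{3/2} ≤ θ + v²θ²`
  have hamgm : 2 * v * θ ^ (3 / 2 : ℝ) ≤ θ + (v * θ) ^ 2 := by
    rw [h32]
    have hs := Real.sq_sqrt hθ.le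
    nlinarith [sq_nonneg (Real.sqrt θ - v * θ), Real.sqrt_nonneg θ, mul_pos hv hθ]
  have hpos : 0 < 2 * v * θ ^ (3 / 2 : ℝ) := by positivity
  calc (θ + (v * θ) ^ 2) ^ (-(1 / 2 : ℝ)) ≤ (2 * v * θ ^ (3 / 2 : ℝ)) ^ (-(1 / 2 : ℝ)) :=
        Real.rpow_le_rpow_of_nonpos hpos hamgm (by norm_num)
    _ = (2 * v) ^ (-(1 / 2 : ℝ)) * θ ^ (-(3 / 4 : ℝ)) := by
        rw [Real.mul_rpow (by positivity) (Real.rpow_nonneg hθ.le _), ← Real.rpow_mul hθ.le]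
        norm_num

/-! ## One-dimensional time integrals -/

/-- `∫_{(0,b]} θ^{-3/4} dθ = 4 b^{1/4}` as a set `∫⁻` (`b > 0`). -/
theorem setLIntegral_Ioc_rpow_neg_three_quarters {b : ℝ} (hb : 0 < b) :
    ∫⁻ θ in Ioc 0 b, ENNReal.ofReal (θ ^ (-(3 / 4 : ℝ))) = ENNReal.ofReal (4 * b ^ (1 / 4 : ℝ)) := by
  have hr : (-1 : ℝ) < -(3 / 4 : ℝ) := by norm_num
  have hint : IntegrableOn (fun θ : ℝ => θ ^ (-(3 / 4 : ℝ))) (Ioc 0 b) := by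
    have h := (intervalIntegral.intervalIntegrable_rpow' hr (a := 0) (b := b))
    rw [intervalIntegrable_iff_integrableOn_Ioc_of_le hb.le] at h
    exact h
  rw [← ofReal_integral_eq_lintegral_ofReal hint]
  · congr 1
    rw [← intervalIntegral.integral_of_le hb.le, integral_rpow (Or.inl hr)]
    rw [Real.zero_rpow (by norm_num)]
    norm_num
    rw [div_eq_mul_inv, show ((1 : ℝ) / 4)⁻¹ = 4 by norm_num, mul_comm]
  · refine (ae_restrict_iff' measurableSet_Ioc).2 (Eventually.of_forall fun θ hθ => ?_)
    exact Real.rpow_nonneg hθ.1.le _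

/-- Reflection of the past onto the future: `∫_{σ < s} G(σ) dσ = ∫_{θ > -s} G(-θ) dθ`. -/
theorem setLIntegral_Iio_eq_Ioi_neg' (G : ℝ → ℝ≥0∞) (s : ℝ) :
    ∫⁻ σ in Iio s, G σ = ∫⁻ θ in Ioi (-s), G (-θ) := by
  have h := (Measure.measurePreserving_neg (volume : Measure ℝ)).setLIntegral_comp_preimage_emb
    (MeasurableEquiv.neg ℝ).measurableEmbedding G (Iio s)
  have hpre : (Neg.neg : ℝ → ℝ) ⁻¹' Iio s = Ioi (-s) := by
    ext θ
    simp only [mem_preimage, mem_Iio, mem_Ioi]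
    constructor <;> intro h <;> linarith
  rw [← h, hpre]

/-- Shift of the past to a forward half-line: `∫_{σ < τ} G(τ - σ) dσ = ∫_{θ > 0} G(θ) dθ`, restricted:
`∫_{σ ∈ Ico s τ} G(τ − σ) dσ = ∫_{θ ∈ Ioc 0 (τ - s)} G(θ) dθ`. -/
theorem setLIntegral_Ico_comp_sub_left (G : ℝ → ℝ≥0∞) (s τ : ℝ) :
    ∫⁻ σ in Ico s τ, G (τ - σ) = ∫⁻ θ in Ioc 0 (τ - s), G θ := by
  have hmp : MeasurePreserving (fun σ : ℝ => τ - σ) volume volume :=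
    Measure.measurePreserving_sub_left volume τ
  have hemb : MeasurableEmbedding (fun σ : ℝ => τ - σ) :=
    (MeasurableEquiv.subLeft τ).measurableEmbedding
  have h := hmp.setLIntegral_comp_preimage_emb hemb G (Ioc 0 (τ - s))
  have hpre : (fun σ : ℝ => τ - σ) ⁻¹' Ioc 0 (τ - s) = Ico s τ := by
    ext σ
    simp only [mem_preimage, mem_Ioc, mem_Ico]
    constructor <;> intro h <;> constructor <;> linarith [h.1, h.2]
  rw [← h, hpre]

/-- **Old times.** For `0 < a`, `8 a² ≤ S` and `-4a² ≤ τ`: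
`∫_{σ < -S} c (τ−σ)^{-1/2} (−σ)⁻¹ dσ ≤ 2√2·c/√S` — on `σ < −S` one has `τ − σ ≥ (−σ)/2`, so the
integrand is at most `√2·c·(−σ)^{-3/2}`, whose integral over `(S, ∞)` is `2√2·c·S^{-1/2}`. -/
theorem lintegral_old_le {a S τ c : ℝ} (ha : 0 < a) (hS : 8 * a ^ 2 ≤ S) (hτ : -(4 * a ^ 2) ≤ τ)
    (hc : 0 ≤ c) :
    ∫⁻ σ in Iio (-S), ENNReal.ofReal (c * (τ - σ) ^ (-(1 / 2 : ℝ)) * (-σ)⁻¹) ≤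
      ENNReal.ofReal (2 * Real.sqrt 2 * c / Real.sqrt S) := by
  have hS0 : 0 < S := lt_of_lt_of_le (by positivity) hS
  rw [setLIntegral_Iio_eq_Ioi_neg']
  simp only [neg_neg, sub_neg_eq_add]
  calc ∫⁻ θ in Ioi S, ENNReal.ofReal (c * (τ + θ) ^ (-(1 / 2 : ℝ)) * θ⁻¹)
      ≤ ∫⁻ θ in Ioi S, ENNReal.ofReal (Real.sqrt 2 * c) * ENNReal.ofReal (θ ^ (-(3 / 2 : ℝ))) := by
        refine setLIntegral_mono' measurableSet_Ioi fun θ hθ => ?_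
        have hθ0 : 0 < θ := hS0.trans hθ
        have hθS : S < θ := hθ
        rw [← ENNReal.ofReal_mul (by positivity)]
        refine ENNReal.ofReal_le_ofReal ?_
        -- `τ + θ ≥ θ / 2`
        have hhalf : θ / 2 ≤ τ + θ := by nlinarith
        have h1 : (τ + θ) ^ (-(1 / 2 : ℝ)) ≤ (θ / 2) ^ (-(1 / 2 : ℝ)) :=
          Real.rpow_le_rpow_of_nonpos (by positivity) hhalf (by norm_num)
        have h2 : (θ / 2) ^ (-(1 / 2 : ℝ)) = Real.sqrt 2 * θ ^ (-(1 / 2 : ℝ)) := by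
          rw [div_eq_mul_inv, Real.mul_rpow hθ0.le (by norm_num)]
          have : ((2 : ℝ)⁻¹) ^ (-(1 / 2 : ℝ)) = Real.sqrt 2 := by
            rw [Real.inv_rpow (by norm_num), ← Real.rpow_neg (by norm_num), neg_neg,
              Real.sqrt_eq_rpow]
          rw [this, mul_comm]
        have h3 : θ ^ (-(3 / 2 : ℝ)) = θ ^ (-(1 / 2 : ℝ)) * θ⁻¹ := by
          rw [← Real.rpow_neg_one, ← Real.rpow_add hθ0]; norm_num
        rw [h3]
        calc c * (τ + θ) ^ (-(1 / 2 : ℝ)) * θ⁻¹ ≤ c * (Real.sqrt 2 * θ ^ (-(1 / 2 : ℝ))) * θ⁻¹ := by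
              rw [← h2]; gcongr
          _ = Real.sqrt 2 * c * (θ ^ (-(1 / 2 : ℝ)) * θ⁻¹) := by ring
    _ = ENNReal.ofReal (Real.sqrt 2 * c) * ENNReal.ofReal (2 * S ^ (-(1 / 2 : ℝ))) := by
        rw [lintegral_const_mul' _ _ ENNReal.ofReal_ne_top, setLIntegral_Ioi_rpow_neg_three_halves hS0]
    _ = ENNReal.ofReal (2 * Real.sqrt 2 * c / Real.sqrt S) := by
        rw [← ENNReal.ofReal_mul (by positivity), Real.rpow_neg hS0.le, ← Real.sqrt_eq_rpow]
        congr 1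
        field_simp

/-- `(16 a²)^{1/4} = 2 √a` for `a ≥ 0`. -/
theorem rpow_quarter_sixteen_mul_sq {a : ℝ} (ha : 0 ≤ a) :
    (16 * a ^ 2) ^ (1 / 4 : ℝ) = 2 * Real.sqrt a := by
  have h : 16 * a ^ 2 = (2 * Real.sqrt a) ^ 4 := by
    have hs : Real.sqrt a ^ 2 = a := Real.sq_sqrt ha
    calc 16 * a ^ 2 = 16 * (Real.sqrt a ^ 2) ^ 2 := by rw [hs]
      _ = (2 * Real.sqrt a) ^ 4 := by ring
  rw [h, show (1 / 4 : ℝ) = ((4 : ℕ) : ℝ)⁻¹ by norm_num,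
    Real.pow_rpow_inv_natCast (by positivity) (by norm_num)]

/-! ## The space integral of one time slice -/

/-- `c₃ > 0`. -/
theorem c₃_pos : 0 < (∫ v : EuclideanSpace ℝ (Fin 3), (1 + ‖v‖ ^ 2) ^ (-(2 : ℝ))) :=
  integral_one_add_norm_sq_rpow_neg_pos (by rw [finrank_euclideanSpace_fin]; norm_num)

/-- The kernel majorant `z ↦ ofReal((a + ‖y - z‖²)⁻¹ ^ 2 · w)` is measurable. -/
theorem measurable_kernelSq_mul (a w : ℝ) (y : EuclideanSpace ℝ (Fin 3)) :
    Measurable fun z : EuclideanSpace ℝ (Fin 3) => ENNReal.ofReal ((a + ‖y - z‖ ^ 2)⁻¹ ^ 2 * w) := by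
  refine Measurable.ennreal_ofReal ?_
  fun_prop

/-- **One time slice.** Let `a > 0`, `y ∈ ℝ³`, `f : ℝ³ → ℝ³`, and split space by a predicate `P` ("near"):
near points carry `‖f z‖² ≤ m·w`, far points carry `‖f z‖ ≤ b` and lie at distance `≥ g` from `y`. Then
`∫ (a+‖y−z‖²)^{-2}‖f z‖² dz ≤ m·∫(a+‖y−z‖²)^{-2}·w dz + 4c₃(a+g²)^{-1/2}b²`
(near: monotonicity; far: `kernelSq_le_four_mul` and `lintegral_kernelSq_mul_const` at time `a + g²`). -/
theorem lintegral_slice_le {a : ℝ} (ha : 0 < a) (y : EuclideanSpace ℝ (Fin 3)) (f : EuclideanSpace ℝ (Fin 3) → EuclideanSpace ℝ (Fin 3)) (P : EuclideanSpace ℝ (Fin 3) → Prop)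
    {m w b g : ℝ} (hm : 0 ≤ m) (hg : 0 ≤ g)
    (hnear : ∀ z, P z → ‖f z‖ ^ 2 ≤ m * w)
    (hfar : ∀ z, ¬ P z → ‖f z‖ ≤ b ∧ g ≤ ‖y - z‖) :
    ∫⁻ z, ENNReal.ofReal ((a + ‖y - z‖ ^ 2)⁻¹ ^ 2 * ‖f z‖ ^ 2) ≤
      ENNReal.ofReal m * (∫⁻ z, ENNReal.ofReal ((a + ‖y - z‖ ^ 2)⁻¹ ^ 2 * w)) +
        ENNReal.ofReal (4 * (∫ v : EuclideanSpace ℝ (Fin 3), (1 + ‖v‖ ^ 2) ^ (-(2 : ℝ))) * (a + g ^ 2) ^ (-(1 / 2 : ℝ)) * b ^ 2) := by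
  have hag : 0 < a + g ^ 2 := by positivity
  have key : ∀ z, ENNReal.ofReal ((a + ‖y - z‖ ^ 2)⁻¹ ^ 2 * ‖f z‖ ^ 2) ≤
      ENNReal.ofReal m * ENNReal.ofReal ((a + ‖y - z‖ ^ 2)⁻¹ ^ 2 * w) +
        ENNReal.ofReal ((a + g ^ 2 + ‖y - z‖ ^ 2)⁻¹ ^ 2 * (4 * b ^ 2)) := by
    intro z
    have hk0 : 0 ≤ (a + ‖y - z‖ ^ 2)⁻¹ ^ 2 := by positivity
    by_cases hz : P z
    · refine le_add_right ?_
      rw [← ENNReal.ofReal_mul hm]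
      refine ENNReal.ofReal_le_ofReal ?_
      calc (a + ‖y - z‖ ^ 2)⁻¹ ^ 2 * ‖f z‖ ^ 2 ≤ (a + ‖y - z‖ ^ 2)⁻¹ ^ 2 * (m * w) :=
            mul_le_mul_of_nonneg_left (hnear z hz) hk0
        _ = m * ((a + ‖y - z‖ ^ 2)⁻¹ ^ 2 * w) := by ring
    · obtain ⟨hfb, hgz⟩ := hfar z hz
      refine le_add_left (ENNReal.ofReal_le_ofReal ?_)
      have hk := kernelSq_le_four_mul ha.le hg hgz
      have hf2 : ‖f z‖ ^ 2 ≤ b ^ 2 := pow_le_pow_left₀ (norm_nonneg _) hfb 2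
      calc (a + ‖y - z‖ ^ 2)⁻¹ ^ 2 * ‖f z‖ ^ 2
          ≤ (4 * (a + g ^ 2 + ‖y - z‖ ^ 2)⁻¹ ^ 2) * b ^ 2 :=
            mul_le_mul hk hf2 (sq_nonneg _) (by positivity)
        _ = (a + g ^ 2 + ‖y - z‖ ^ 2)⁻¹ ^ 2 * (4 * b ^ 2) := by ring
  calc ∫⁻ z, ENNReal.ofReal ((a + ‖y - z‖ ^ 2)⁻¹ ^ 2 * ‖f z‖ ^ 2)
      ≤ ∫⁻ z, (ENNReal.ofReal m * ENNReal.ofReal ((a + ‖y - z‖ ^ 2)⁻¹ ^ 2 * w) +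
          ENNReal.ofReal ((a + g ^ 2 + ‖y - z‖ ^ 2)⁻¹ ^ 2 * (4 * b ^ 2))) := lintegral_mono key
    _ = ENNReal.ofReal m * (∫⁻ z, ENNReal.ofReal ((a + ‖y - z‖ ^ 2)⁻¹ ^ 2 * w)) +
          ∫⁻ z, ENNReal.ofReal ((a + g ^ 2 + ‖y - z‖ ^ 2)⁻¹ ^ 2 * (4 * b ^ 2)) := by
        rw [lintegral_add_left ((measurable_kernelSq_mul a w y).const_mul _),
          lintegral_const_mul' _ _ ENNReal.ofReal_ne_top]
    _ = ENNReal.ofReal m * (∫⁻ z, ENNReal.ofReal ((a + ‖y - z‖ ^ 2)⁻¹ ^ 2 * w)) +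
          ENNReal.ofReal ((∫ v : EuclideanSpace ℝ (Fin 3), (1 + ‖v‖ ^ 2) ^ (-(2 : ℝ))) * (a + g ^ 2) ^ (-(1 / 2 : ℝ))) * ENNReal.ofReal (4 * b ^ 2) := by
        rw [lintegral_kernelSq_mul_const hag (4 * b ^ 2) y]
    _ = _ := by
        rw [← ENNReal.ofReal_mul (by positivity)]
        congr 2
        ring

/-- Five nonnegative reals: the sum of `ofReal`s is the `ofReal` of the sum (grouped as used below). -/
theorem ofReal_add_five {T₁ T₂ T₃ T₄ T₅ : ℝ} (h₁ : 0 ≤ T₁) (h₂ : 0 ≤ T₂) (h₃ : 0 ≤ T₃) (h₄ : 0 ≤ T₄)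
    (h₅ : 0 ≤ T₅) :
    ENNReal.ofReal T₁ + (ENNReal.ofReal T₂ + ENNReal.ofReal T₃) + (ENNReal.ofReal T₄ + ENNReal.ofReal T₅) =
      ENNReal.ofReal (T₁ + (T₂ + T₃) + (T₄ + T₅)) := by
  rw [← ENNReal.ofReal_add h₂ h₃, ← ENNReal.ofReal_add h₄ h₅, ← ENNReal.ofReal_add h₁ (add_nonneg h₂ h₃),
    ← ENNReal.ofReal_add (add_nonneg h₁ (add_nonneg h₂ h₃)) (add_nonneg h₄ h₅)]

end Summit.NavierStokesRegularity.NavierStokesRegularity.Theorems.NearExtremalTransiencePerFlow.LocalKatoGap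

end
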